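import Mathlib
import HarnessLib
import HarnessLib.Audit
import Summits.CriticalPhenomena.Ising3DConformalLimit.Theses.PrecisionLaplacian

/-!
# Line `nine-frame-cross-analyticity` — skeleton for crux `DirectCorrelationStableTail`
(item stmt-CriticalPhenomena-4799, route `PrecisionLaplacian`, rank 3; file `Lines/nine_frame_cross_analyticity.lean` —
underscores so that the module `…Cruxes.DirectCorrelationStableTail.Lines.nine_frame_cross_analyticity` is importable,
as the sibling lines do; card `Lines/nine-frame-cross-analyticity.md`)

Crux (by name, `Summit.CriticalPhenomena.Ising3DConformalLimit.Theses.PrecisionLaplacian.DirectCorrelationStableTail`):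
`H → TAIL`, where `H` = every finite kernel matrix `G_A` of `G := criticalTwoPoint 3` is a symmetric potential and
`TAIL` = the direct correlation function `a = dcf` has a stable tail `a(x)|x|₂^{5-η} - Φ(x̂) → 0` (`η ∈ (0,1)`,
`Φ ≥ 0` continuous, `Φ ≢ 0`).

THE LINE (idea card `Ideas/nine-frame-cross-analyticity.md`, triage TRIAGE-r1-{1,2,3}.md all `pass`):
reflection positivity in the NINE transfer frames `u ∈ {eᵢ, eᵢ ± eⱼ}` makes `F := Ĝ = 1/ψ` (ψ = the Lévy–Khintchine
symbol of `a`, available under `H` through the route's dictionary item `PrecisionIsLaplacian`) a one-variable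
Poisson–Stieltjes integral along every frame line, with a singular set `{Re(k·u) ∈ 2πℤ}` that does not depend on the
representing measure; three independent good frames exist at every `k ∉ 2πℤ³`, so the Bernstein–Siciak CROSS THEOREM
gives joint real-analyticity of `F` on `T³ ∖ {0}` with a SCALE-INVARIANT analyticity radius `≥ c|k|` and domination
by real values (the UV half of TAIL, unconditional); the infrared half is isolated as ONE germ statement `C⁺`
(pure-power multivariate regular variation of `ψ` at `0`), and a harmonic-analysis inversion lemma turns
`dictionary + symbol class + C⁺` into TAIL verbatim.

REGISTERED STUBS (6; `sorry` only inside them; signatures are the named packages below — import this module — and the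
Appendix `expanded_*` theorems give their `Iff.rfl`-certified verbatim expansions for an import-free restatement):
* `stub_nineFrameMoments`  — nine-frame RP moment representation of `criticalTwoPoint 3` (M–L, provable now);
* `stub_framePackage`      — `H` + dictionary + moments ⇒ `dcf` even ∧ nine-frame Poisson package of `F = 1/ψ` (M–L);
* `stub_crossLemma`        — the 3-fold cross theorem, intervals × discs (Bernstein 1912 / Siciak 1969 /
                             Jarnicki–Pflug 2002 Main Thm with `M = ∅`; L to formalise, TRUE in print);
* `stub_crossAnalyticity`  — cross lemma + frame geometry ⇒ `C^∞` off the lattice + scale-invariant Cauchy bounds (M–L);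
* `stub_infraredGerm`      — THE HARDEST (the card's Transfer `C⁺`; existence core, open-problem strength);
* `stub_symbolInversion`   — abstract Tauberian-with-regularity inversion ⇒ `HasStableTail` (L).
COMPOSITION: `DirectCorrelationStableTail_of` (kernel-checked, no `sorry`) takes the six `Registered.stub_*`
hypotheses + the route's support item `PrecisionIsLaplacian` (stmt-CriticalPhenomena-4803, admissible by name) and
concludes the crux decl BY NAME; `DirectCorrelationStableTail_proof` wires the actual stubs in.

Disproof.lean (cycle 2) honoured: `not_cruxSchema_delta` / `not_cruxSchema_halfGreen` /
`not_forall_isingEnvelope_localSimonLieb_cruxSchema` — the only stub that is false for `δ₀` and for the Green kernel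
`G₀` is `stub_infraredGerm` (their germs have `η = 0`), i.e. the Ising input "of `η(3) > 0` + regular-variation
strength" enters exactly there, as it must; `not_hasStableTail_parityModulated` (§5) and the §7.3 near-miss are the
UV failure modes excluded by `stub_crossAnalyticity` (a parity-modulated `a` has a symbol that is not smooth at the
staggered momenta); no stub is an instance of a refuted strengthening (none claims bounds ⇒ TAIL or
`G`-asymptotics ⇒ TAIL). No `Theorems/DirectCorrelationStableTail/Negative/` lemma exists yet (nothing to import).
-/

noncomputable section

namespace Summit.CriticalPhenomena.Ising3DConformalLimit.Cruxes.DirectCorrelationStableTail.NineFrameCrossAnalyticity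

open MeasureTheory Filter Set
open scoped BigOperators Topology Matrix
open Literature.Probability.LatticeModels

/-! ## Vocabulary — verbatim copies of the crux's inlined objects and the line's packages -/

/-- `H`: every finite kernel matrix of the critical two-point function is a symmetric potential — the crux's
antecedent VERBATIM (also the antecedent of the route items `PrecisionIsLaplacian`, `EtaBoundsTransfer`, …). -/
def HPot : Prop :=
  ∀ A : Finset (Site 3), (Matrix.of fun (p q : ↥A) => criticalTwoPoint 3 (q.1 - p.1)).PosDef ∧
    ∀ u v : ↥A, (u ≠ v → (Matrix.of fun (p q : ↥A) => criticalTwoPoint 3 (q.1 - p.1))⁻¹ u v ≤ 0) ∧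
      0 ≤ ∑ w, (Matrix.of fun (p q : ↥A) => criticalTwoPoint 3 (q.1 - p.1))⁻¹ u w

/-- The (signed) direct correlation function `m(y) = inf_{A ∋ 0,y} -(G_A)⁻¹(0,y)` of the crux, VERBATIM
(`m(y) = a(y) ≥ 0` for `y ≠ 0`, `m(0) = -A₀ < 0` under `H`; the same expression appears in `PrecisionIsLaplacian`). -/
def dcf (y : Site 3) : ℝ :=
  ⨅ A : {A : Finset (Site 3) // (0 : Site 3) ∈ A ∧ y ∈ A},
    -((Matrix.of fun (p q : ↥A.1) => criticalTwoPoint 3 (q.1 - p.1))⁻¹ ⟨0, A.2.1⟩ ⟨y, A.2.2⟩)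

/-- The Laplacian dictionary = the CONCLUSION of route item `PrecisionIsLaplacian` (stmt-4803) read through `dcf`:
`m` summable, `Σ m = 0` (conservativity), `m ≥ 0` off the origin, `m(0) < 0`, and `m ∗ G = -δ₀`. -/
def LaplacianDict : Prop :=
  Summable dcf ∧ (∑' y : Site 3, dcf y) = 0 ∧ (∀ y : Site 3, y ≠ 0 → 0 ≤ dcf y) ∧ dcf 0 < 0 ∧
    ∀ z : Site 3, (∑' y : Site 3, dcf y * criticalTwoPoint 3 (z - y)) = if z = 0 then -1 else 0

/-- The Lévy–Khintchine / precision SYMBOL of a summable `m : ℤ³ → ℝ`: `ψ_m(k) = -Σ_y m(y) cos(k·y)`; for `m = dcf`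
under the dictionary `ψ = A₀ - Σ_{y≠0} a(y) cos(k·y) = Σ_{y≠0} a(y)(1 - cos(k·y)) ≥ 0`, `ψ(0) = 0`, `Ĝ = 1/ψ`. -/
def symb (m : Site 3 → ℝ) (k : Fin 3 → ℝ) : ℝ :=
  - ∑' y : Site 3, m y * Real.cos (∑ i, k i * (y i : ℝ))

/-- `k ∉ 2πℤ³` (the complement of the reciprocal lattice, where `ψ > 0`). -/
def OffLattice (k : Fin 3 → ℝ) : Prop :=
  ¬ ∀ i : Fin 3, ∃ n : ℤ, k i = 2 * Real.pi * n

/-- The nine frame vectors `u ∈ {eᵢ} ∪ {eᵢ + eⱼ, eᵢ - eⱼ : i ≠ j}` (up to sign: 3 axes + 6 face diagonals). -/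
def IsFrame (u : Site 3) : Prop :=
  (∃ i : Fin 3, u = Pi.single i 1) ∨
    ∃ i j : Fin 3, i ≠ j ∧ (u = Pi.single i 1 + Pi.single j 1 ∨ u = Pi.single i 1 - Pi.single j 1)

/-- The lattice mirror with normal `u`: `x ↦ x - (2(u·x)/(u·u)) u` (for a frame vector the quotient is an integer:
`xᵢ ↦ -xᵢ` for `u = eᵢ`; `(xᵢ,xⱼ) ↦ (-xⱼ,-xᵢ)` for `u = eᵢ + eⱼ`; the swap for `u = eᵢ - eⱼ`). -/
def mirror (u x : Site 3) : Site 3 :=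
  x - ((2 * (u ⬝ᵥ x)) / (u ⬝ᵥ u)) • u

/-- `k·u` for a real momentum and an integer vector. -/
def rdot (k : Fin 3 → ℝ) (u : Site 3) : ℝ := ∑ i, k i * (u i : ℝ)

/-- The dual step `w_u = u/|u|²` of a frame (`w_u · u = 1`): moving `k` along `w_u` changes the frame momentum
`k·u` at fixed frame-transverse momenta (`eᵢ` for an axis, `(eᵢ ± eⱼ)/2` for a face diagonal). -/
def dualStep (u : Site 3) : Fin 3 → ℝ := fun i => (u i : ℝ) / ∑ j, ((u j : ℝ)) ^ 2

/-- The Poisson kernel `P(s, φ) = (1 - s²)/(1 - 2s cos φ + s²)`, `s ∈ (-1,1)`: as a function of complex `φ` it is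
singular exactly on `{Re φ ∈ πℤ}` and dominated there-off by its value at a real point (`|P(s,φ)| ≤ P(s,φ')`,
`cos φ' = Re cos φ` when `|Re cos φ| < 1`). -/
def poissonKernel (s φ : ℝ) : ℝ := (1 - s ^ 2) / (1 - 2 * s * Real.cos φ + s ^ 2)

/-- OUTPUT OF STUB 1 (reflection positivity in the nine frames, moment form): for every frame `u`, every finitely
supported real test vector `c` on the CLOSED half-space `{u·x ≥ 0}` (sites on the mirror allowed: non-strict RP) has `n ↦ Σ_{x,y} c_x c_y G(y + n u - θ_u x)`
(`= ⟨F, τ_uⁿ F⟩_OS`, `F = Σ c_x σ_x`) equal to the moment sequence of a finite positive measure on `[0,1]`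
(`τ_u = θ'θ ≥ 0`: bond mirror for an axis, the parallel site mirror `u·x = 1` for a diagonal — ADC21 Prop 8.6 /
"TT* ≥ 0", tree `TorusTransferSpectral`, `RotatedTorusLayers.diagTransfer_posSemidef` in finite volume). -/
def NineFrameMoments (G : Site 3 → ℝ) : Prop :=
  ∀ u : Site 3, IsFrame u → ∀ (s : Finset (Site 3)) (c : Site 3 → ℝ), (∀ x ∈ s, 0 ≤ u ⬝ᵥ x) →
    ∃ μ : Measure ℝ, IsFiniteMeasure μ ∧ μ (Set.Icc (0 : ℝ) 1)ᶜ = 0 ∧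
      ∀ n : ℕ, (∑ x ∈ s, ∑ y ∈ s, c x * c y * G (y + (n : ℤ) • u - mirror u x)) = ∫ t, t ^ n ∂μ

/-- OUTPUT OF STUB 2 / INPUT OF STUB 4 (the nine-frame Poisson package of a function `F` on momentum space):
`F` is continuous and positive off the reciprocal lattice, `2π`-periodic in each coordinate, and along every frame
line `t ↦ k + t w_u` that avoids `2πℤ³` it is the Poisson integral `F(k + t w_u) = ∫ P(s, (k·u + t)/2) dμ(s)` of a
finite positive measure on the OPEN interval `(-1,1)` (half-angle form: axes give symmetric `μ` — `P_λ(κ)` is the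
average of `P_{±√λ}(κ/2)` — and the face diagonals a self-adjoint, not positive, layer operator). -/
def FramePackage (F : (Fin 3 → ℝ) → ℝ) : Prop :=
  ContinuousOn F {k | OffLattice k} ∧
  (∀ k : Fin 3 → ℝ, OffLattice k → 0 < F k) ∧
  (∀ (k : Fin 3 → ℝ) (i : Fin 3), F (k + Pi.single i (2 * Real.pi)) = F k) ∧
  ∀ u : Site 3, IsFrame u → ∀ k : Fin 3 → ℝ, (∀ t : ℝ, OffLattice (k + t • dualStep u)) →
    ∃ μ : Measure ℝ, IsFiniteMeasure μ ∧ μ (Set.Ioo (-1 : ℝ) 1)ᶜ = 0 ∧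
      ∀ t : ℝ, F (k + t • dualStep u) = ∫ s, poissonKernel s ((rdot k u + t) / 2) ∂μ

/-- OUTPUT OF STUB 4 / INPUT OF STUB 6 (the analytic package): `F` is `C^∞` off the reciprocal lattice and obeys
SCALE-INVARIANT Cauchy bounds at the origin — every derivative of order `n` at `k` costs `‖k‖⁻ⁿ` times a value of
`F` at a real point of the ball `‖k' - k‖ ≤ ‖k‖/2` (analyticity radius `≥ c‖k‖` + domination by real values). -/
def AnalyticPackage (F : (Fin 3 → ℝ) → ℝ) : Prop :=
  ContDiffOn ℝ (⊤ : ℕ∞) F {k | OffLattice k} ∧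
  ∀ n : ℕ, ∃ C r : ℝ, 0 < r ∧ ∀ k : Fin 3 → ℝ, k ≠ 0 → ‖k‖ ≤ r →
    ∃ k' : Fin 3 → ℝ, ‖k' - k‖ ≤ ‖k‖ / 2 ∧ ‖iteratedFDeriv ℝ n F k‖ * ‖k‖ ^ n ≤ C * F k'

/-- OUTPUT OF STUB 5 / INPUT OF STUB 6 (the infrared germ `C⁺`, the card's Transfer): pure-power multivariate
regular variation of the symbol at the origin — `ψ(s k)/s^{2-η} → |k|₂^{2-η} Θ(k̂)` as `s → 0⁺`, uniformly on the
shell `1 ≤ |k|₂ ≤ 2` (equivalently locally uniformly on `ℝ³ ∖ 0`), with `η ∈ (0,1)` and `Θ > 0` continuous on the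
unit sphere. NO remainder rates, NO derivatives (those are supplied by the analytic package). -/
def GermPackage (ψ : (Fin 3 → ℝ) → ℝ) : Prop :=
  ∃ (η : ℝ) (Θ : (Fin 3 → ℝ) → ℝ), 0 < η ∧ η < 1 ∧ ContinuousOn Θ {u | ∑ i, u i ^ 2 = 1} ∧
    (∀ u : Fin 3 → ℝ, ∑ i, u i ^ 2 = 1 → 0 < Θ u) ∧
    ∀ ε : ℝ, 0 < ε → ∃ s₀ : ℝ, 0 < s₀ ∧ ∀ s : ℝ, 0 < s → s < s₀ → ∀ k : Fin 3 → ℝ,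
      1 ≤ Real.sqrt (∑ i, k i ^ 2) → Real.sqrt (∑ i, k i ^ 2) ≤ 2 →
        |ψ (s • k) / s ^ (2 - η) -
            Real.sqrt (∑ i, k i ^ 2) ^ (2 - η) * Θ (fun i => k i / Real.sqrt (∑ j, k j ^ 2))| < ε

/-- INPUT OF STUB 4 = OUTPUT OF STUB 3: the 3-fold CROSS THEOREM for intervals in discs (Bernstein 1912 for two
variables; Siciak, Ann. Polon. Math. 22 (1969/70); Jarnicki–Pflug, Trans. AMS 355 (2003) = arXiv:math/0112082, Main
Theorem with `M = ∅`, `A_j = [-1,1] ⊂ D_j = {|z| < 2}` locally regular): a function of three complex variables that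
is SEPARATELY holomorphic on the cross `X = ⋃ⱼ A × ⋯ × D_j × ⋯ × A` (each variable in the disc, the others REAL in
`[-1,1]`) and bounded by `M` there agrees on `X` near `0` with a function holomorphic on a fixed polydisc
`{‖zᵢ‖ < ρ}`, bounded by the same `M` (two-constants estimate). `ρ` depends on the geometry only. -/
def CrossLemma : Prop :=
  ∃ ρ : ℝ, 0 < ρ ∧ ∀ (f : (Fin 3 → ℂ) → ℂ) (M : ℝ),
    (∀ (j : Fin 3) (a : Fin 3 → ℝ), (∀ i, |a i| ≤ 1) →
        DifferentiableOn ℂ (fun z : ℂ => f (Function.update (fun i => ((a i : ℝ) : ℂ)) j z))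
          (Metric.ball (0 : ℂ) 2)) →
    (∀ (j : Fin 3) (a : Fin 3 → ℝ) (z : ℂ), (∀ i, |a i| ≤ 1) → ‖z‖ < 2 →
        ‖f (Function.update (fun i => ((a i : ℝ) : ℂ)) j z)‖ ≤ M) →
    ∃ g : (Fin 3 → ℂ) → ℂ, AnalyticOnNhd ℂ g {z | ∀ i, ‖z i‖ < ρ} ∧
      (∀ z : Fin 3 → ℂ, (∀ i, ‖z i‖ < ρ) → ‖g z‖ ≤ M) ∧
      ∀ (j : Fin 3) (a : Fin 3 → ℝ) (z : ℂ), (∀ i, |a i| ≤ 1) → ‖z‖ < 2 →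
        (∀ i, ‖Function.update (fun i => ((a i : ℝ) : ℂ)) j z i‖ < ρ) →
          g (Function.update (fun i => ((a i : ℝ) : ℂ)) j z) = f (Function.update (fun i => ((a i : ℝ) : ℂ)) j z)

/-- `TAIL` for a function `a : ℤ³ → ℝ` — the crux's consequent VERBATIM with the direct correlation function
abstracted (same rendering as `Disproof.HasStableTail`): `a(x)·|x|₂^{5-η} - Φ(x/|x|₂) → 0` cofinitely for some
`η ∈ (0,1)` and some `Φ` continuous, `≥ 0`, `≢ 0` on the unit sphere. -/
def HasStableTail (a : Site 3 → ℝ) : Prop :=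
  ∃ (η : ℝ) (Φ : (Fin 3 → ℝ) → ℝ), 0 < η ∧ η < 1 ∧ ContinuousOn Φ {u | ∑ i, u i ^ 2 = 1} ∧
    (∀ u : Fin 3 → ℝ, ∑ i, u i ^ 2 = 1 → 0 ≤ Φ u) ∧ (∃ u : Fin 3 → ℝ, ∑ i, u i ^ 2 = 1 ∧ 0 < Φ u) ∧
    Filter.Tendsto (fun x : Site 3 => a x * Real.sqrt (∑ j, ((x j : ℝ)) ^ 2) ^ (5 - η) -
      Φ (fun i => (x i : ℝ) / Real.sqrt (∑ j, ((x j : ℝ)) ^ 2))) Filter.cofinite (nhds 0)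

/-! ## Definitional bridges (checked: the local vocabulary IS the route's text) -/

/-- The crux is literally `HPot → HasStableTail dcf`. -/
theorem crux_iff : Theses.PrecisionLaplacian.DirectCorrelationStableTail ↔ (HPot → HasStableTail dcf) :=
  Iff.rfl

/-- Route item `PrecisionIsLaplacian` (stmt-4803) is literally `HPot → LaplacianDict`. -/
theorem precisionIsLaplacian_iff : Theses.PrecisionLaplacian.PrecisionIsLaplacian ↔ (HPot → LaplacianDict) :=
  Iff.rfl

/-! ## The six registered stubs (signatures = the named packages of this importable module; `sorry` only here;
the Appendix certifies their verbatim expansions over tree / Mathlib declarations by `Iff.rfl`) -/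

/-- STUB 1 `stub_nineFrameMoments` — `NineFrameMoments (criticalTwoPoint 3)` (expanded: `expanded_nineFrameMoments`). Reflection positivity of
the critical plus state for the nine SITE mirrors (tree: `CriticalCorrNineMirrorRP` proved, item 1985;
`isingTorus_reflectionPositive_sites_holds`) and the BOND mirrors orthogonal to the axes
(`isingTorus_reflectionPositive_bonds_holds`), passed to `β_c`/infinite volume (`hasUniqueGibbsMeasure_criticalBeta_holds`,
torus/box limits), makes `τ_u = θ'θ` a positive self-adjoint contraction on the OS space of `θ_u`, whose spectral
resolution gives the moments. Axis case with `v = δ`: `AizenmanDuminilCopin2021_prop_8_6_holds`; OS machinery: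
`IsingAxisOSRealisation`, `OSReconstruction`. Size M–L, provable now. -/
theorem stub_nineFrameMoments :
    NineFrameMoments (criticalTwoPoint 3) := by
  sorry

/-- STUB 2 `stub_framePackage` — `HPot → LaplacianDict → NineFrameMoments (criticalTwoPoint 3) →
(dcf even) ∧ FramePackage (1/ψ)` (expanded: `expanded_framePackage`). Content: `dcf(-y) = dcf(y)` (reindex the infimum by `A ↦ -A`,
`G` even: `criticalTwoPoint_neg`); `ψ` continuous (absolutely convergent series), `2π`-periodic; `m ∗ G = -δ₀` and
`G → 0` identify the spectral measure of `G` with `dk/ψ` and force `ψ > 0` off `2πℤ³` (`G > 0` off no sublattice: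
`criticalTwoPoint_bounds_holds`); per frame and per transverse momentum the moments of stub 1 give, by the spectral
resolution of the self-adjoint layer contraction `S = e^{-iα/2} τ_{step}` (`S² = τ_u ≥ 0`), the layer coefficients
`h(ℓ) = e^{iℓα/2} ∫ s^ℓ dE(s)`, `E ≥ 0` on `[-1,1]`, and Poisson resummation gives the half-angle representation with
no atoms at `±1` (the line avoids the lattice, so `F` is bounded on it). Size M–L. -/
theorem stub_framePackage :
    HPot → LaplacianDict → NineFrameMoments (criticalTwoPoint 3) →
      (∀ y : Site 3, dcf (-y) = dcf y) ∧ FramePackage (fun k => 1 / symb dcf k) := by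
  sorry

/-- STUB 3 `stub_crossLemma` — `CrossLemma` (expanded: `expanded_crossLemma`): the classical cross theorem (separately holomorphic on a
3-fold cross of real intervals in discs, bounded ⇒ holomorphic on a neighbourhood of the real cube, same bound).
A published theorem (Bernstein–Siciak; Jarnicki–Pflug arXiv:math/0112082 Main Theorem, `N = 3`, `M = ∅`,
`A_j = [-1,1]` locally regular in `D_j = B(0,2)`; `X̂ = {Σ ω_{A_j,D_j}(z_j) < 1} ⊃` a polydisc; two-constants bound)
not in Mathlib: to be vendored/proved. Size L. -/
theorem stub_crossLemma :
    CrossLemma := by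
  sorry

/-- STUB 4 `stub_crossAnalyticity` — `CrossLemma → ∀ F, FramePackage F → AnalyticPackage F` (expanded: `expanded_crossAnalyticity`): THE LEVER.
One variable: `t ↦ ∫ P(s,(κ+t)/2) dμ` extends holomorphically off `{Re(κ+t) ∈ 2πℤ}` with `|·| ≤` its value at a
nearby REAL point (`|1 - 2s cos φ + s²| ≥ 1 - 2s Re cos φ + s²` when `|Re cos φ| < 1`). Geometry: at every
`k ∉ 2πℤ³` three linearly independent frames are good (`k·u ∉ 2πℤ`) with lattice-avoiding lines (checked
exhaustively on the `π/12, π/8` grids + random; near `0` quantitatively: `min(|k̂·û|, dist(k̂, ℝu)) ≥ 0.38` for the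
best triple), so `F` is separately holomorphic and bounded on a cross in the oblique coordinates `k = k⁰ + Σ tⱼ w_{uⱼ}`;
the cross lemma (after the dilation `t = ε‖k⁰‖ z`) gives a holomorphic extension to a complex ball of radius
`c‖k⁰‖` dominated by `sup {F(k') : ‖k'-k⁰‖ ≤ ‖k⁰‖/2}`, whence real-analyticity (`C^∞`) and the Cauchy bounds.
Size M–L. -/
theorem stub_crossAnalyticity :
    CrossLemma → ∀ F : (Fin 3 → ℝ) → ℝ, FramePackage F → AnalyticPackage F := by
  sorry

/-- STUB 5 `stub_infraredGerm` — `HPot → LaplacianDict → GermPackage (symb dcf)` (expanded: `expanded_infraredGerm`): THE HARDEST STUB, the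
card's Transfer `C⁺` = the existence core shared with every two-point route of the sub-problem (pure-power regular
variation of the precision germ with an angular limit; `η(3) > 0` lives here). False for the Disproof's `δ₀` and Green
kernel `G₀` (germ degree `2`, `η = 0`) — this is where input beyond `IsingEnvelope` must enter; the card-level barrier
`rp-cannot-fix-the-scale-log-periodic` bites here and only here. Why it is nevertheless the right residue: it has no
lattice-scale content, is EQUIVALENT to TAIL given the other stubs (Abelian direction), is the Fourier dual of item
0634's isotropic law at the level of `ψ`, and complex structure is available at the germ (analyticity on the complex
cone `|Im k| < c|Re k|` with nine Stieltjes sections — the arena for Phragmén–Lindelöf arguments against angular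
log-periodicity; tangent symbols keep the linear gap, which already excludes the coordinate-separable stable symbol
`Σ|kᵢ|^α` of crux r4). Open-problem strength. -/
theorem stub_infraredGerm :
    HPot → LaplacianDict → GermPackage (symb dcf) := by
  sorry

/-- STUB 6 `stub_symbolInversion` (expanded: `expanded_symbolInversion`) — the abstract inversion lemma (harmonic analysis, no Ising content): for an even
summable `m : ℤ³ → ℝ` with `Σ m = 0`, `m ≥ 0` off the origin, whose symbol `ψ = -Σ m(y) cos(k·y)` is positive off
`2πℤ³`, has `1/ψ` in the analytic package and satisfies the germ statement, `m` has a stable tail. Proof sketch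
(checked on paper): Cauchy bounds + the germ's two-sided power bounds ⇒ `|∂^γ ψ(k)| ≤ C_γ |k|^{2-η-|γ|}` (Faà di
Bruno); Arzelà–Ascoli upgrades the uniform shell convergence to `C^∞` convergence, so `Θ ∈ C^∞(S²)` and
`r = ψ - |k|^{2-η}Θ(k̂)` is an `o`-symbol of order `2-η`; `-m(x)` is the `x`-th Fourier coefficient of `ψ` (`m`
even, `ℓ¹`); split `ψ = χψ + (1-χ)ψ`: the smooth part has `O(|x|^{-N})` coefficients, `F⁻¹[χ r] = o(|x|^{-5+η})`
(dyadic pieces), and `F⁻¹[σ₀]`, `σ₀ = |k|^{2-η}Θ(k̂)` homogeneous of non-integer degree, is `-|x|^{-5+η}Φ(x̂)` with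
`Φ ∈ C^∞(S²)` (Hörmander I Thm 7.1.18), `Φ ≥ 0` by `m ≥ 0` and density of lattice directions, `Φ ≢ 0` since `σ₀` is
not a polynomial. The UV remainder is `O(|x|^{-N}) ∀N` (triage sharpening), not `e^{-c|x|}`. Size L. -/
theorem stub_symbolInversion :
    ∀ m : Site 3 → ℝ, Summable m → (∑' y, m y) = 0 → (∀ y, y ≠ 0 → 0 ≤ m y) → (∀ y, m (-y) = m y) →
      (∀ k : Fin 3 → ℝ, OffLattice k → 0 < 1 / symb m k) →
      AnalyticPackage (fun k => 1 / symb m k) → GermPackage (symb m) → HasStableTail m := by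
  sorry

/-! ## Name-keyed aliases of the stub statements (the skeleton audit admits a hypothesis whose head's last name
component is a declared stub; same device as `Lines/root-locality-replaces-loewner.lean` of crux `HexConjecture`) -/

namespace Registered

/-- Statement of `stub_nineFrameMoments`. -/
abbrev stub_nineFrameMoments : Prop := NineFrameMoments (criticalTwoPoint 3)
/-- Statement of `stub_framePackage`. -/
abbrev stub_framePackage : Prop :=
  HPot → LaplacianDict → NineFrameMoments (criticalTwoPoint 3) →
    (∀ y : Site 3, dcf (-y) = dcf y) ∧ FramePackage (fun k => 1 / symb dcf k)
/-- Statement of `stub_crossLemma`. -/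
abbrev stub_crossLemma : Prop := CrossLemma
/-- Statement of `stub_crossAnalyticity`. -/
abbrev stub_crossAnalyticity : Prop := CrossLemma → ∀ F : (Fin 3 → ℝ) → ℝ, FramePackage F → AnalyticPackage F
/-- Statement of `stub_infraredGerm`. -/
abbrev stub_infraredGerm : Prop := HPot → LaplacianDict → GermPackage (symb dcf)
/-- Statement of `stub_symbolInversion`. -/
abbrev stub_symbolInversion : Prop :=
  ∀ m : Site 3 → ℝ, Summable m → (∑' y, m y) = 0 → (∀ y, y ≠ 0 → 0 ≤ m y) → (∀ y, m (-y) = m y) →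
    (∀ k : Fin 3 → ℝ, OffLattice k → 0 < 1 / symb m k) →
    AnalyticPackage (fun k => 1 / symb m k) → GermPackage (symb m) → HasStableTail m

end Registered

/-! ## Composition: the stubs imply the crux BY NAME (kernel-checked, no `sorry` outside the stubs) -/

/-- **The line closes the crux.** From the six registered stub statements and the route's dictionary item
`PrecisionIsLaplacian` (stmt-CriticalPhenomena-4803, support): `DirectCorrelationStableTail`. Pure logic. -/
theorem DirectCorrelationStableTail_of
    (h1 : Registered.stub_nineFrameMoments) (h2 : Registered.stub_framePackage)
    (h3 : Registered.stub_crossLemma) (h4 : Registered.stub_crossAnalyticity)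
    (h5 : Registered.stub_infraredGerm) (h6 : Registered.stub_symbolInversion)
    (hPIL : Theses.PrecisionLaplacian.PrecisionIsLaplacian) :
    Theses.PrecisionLaplacian.DirectCorrelationStableTail := by
  intro hH
  have hD : LaplacianDict := hPIL hH
  obtain ⟨heven, hFP⟩ := h2 hH hD h1
  have hA : AnalyticPackage (fun k => 1 / symb dcf k) := h4 h3 _ hFP
  have hG : GermPackage (symb dcf) := h5 hH hD
  exact h6 dcf hD.1 hD.2.1 hD.2.2.1 heven hFP.2.1 hA hG

/-- Wiring check: the actual `stub_*` theorems feed `DirectCorrelationStableTail_of` as stated (closed modulo the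
`sorry`s inside the six stubs and the route item `PrecisionIsLaplacian`). -/
theorem DirectCorrelationStableTail_proof (hPIL : Theses.PrecisionLaplacian.PrecisionIsLaplacian) :
    Theses.PrecisionLaplacian.DirectCorrelationStableTail :=
  DirectCorrelationStableTail_of stub_nineFrameMoments stub_framePackage stub_crossLemma stub_crossAnalyticity
    stub_infraredGerm stub_symbolInversion hPIL

/-! ## Appendix — verbatim expansions of the registered stub statements over tree / Mathlib declarations
(`Iff.rfl`: definitional unfolding only). A prover who prefers not to import this module can restate a stub with the
right-hand side below; the text is generated from the named packages by macro expansion (planner folder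
`exp/gen_stubs.py`) and each equivalence is kernel-checked here. -/

theorem expanded_nineFrameMoments : Registered.stub_nineFrameMoments ↔
    (∀ u : Literature.Probability.LatticeModels.Site 3, ((∃ i : Fin 3, u = Pi.single i 1) ∨ ∃ i j : Fin 3,
      i ≠ j ∧ (u = Pi.single i 1 + Pi.single j 1 ∨ u = Pi.single i 1 - Pi.single j 1)) →
      ∀ (s : Finset (Literature.Probability.LatticeModels.Site 3)) (c :
      Literature.Probability.LatticeModels.Site 3 → ℝ), (∀ x ∈ s, 0 ≤ u ⬝ᵥ x) →
      ∃ μ : MeasureTheory.Measure ℝ, MeasureTheory.IsFiniteMeasure μ ∧ μ (Set.Icc (0 : ℝ) 1)ᶜ = 0 ∧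
      ∀ n : ℕ, (∑ x ∈ s, ∑ y ∈ s, c x * c y * Literature.Probability.LatticeModels.criticalTwoPoint 3 (y +
      (n : ℤ) • u - (x - ((2 * (u ⬝ᵥ x)) / (u ⬝ᵥ u)) • u))) = ∫ t, t ^ n ∂μ) :=
  Iff.rfl

theorem expanded_framePackage : Registered.stub_framePackage ↔
    ((∀ A : Finset (Literature.Probability.LatticeModels.Site 3),
      (Matrix.of fun (p q : ↥A) => Literature.Probability.LatticeModels.criticalTwoPoint 3 (q.1 -
      p.1)).PosDef ∧ ∀ u v : ↥A, (u ≠ v → (Matrix.of fun (p q : ↥A) =>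
      Literature.Probability.LatticeModels.criticalTwoPoint 3 (q.1 - p.1))⁻¹ u v ≤ 0) ∧
      0 ≤ ∑ w, (Matrix.of fun (p q : ↥A) => Literature.Probability.LatticeModels.criticalTwoPoint 3 (q.1 -
      p.1))⁻¹ u w) → (Summable (fun y : Literature.Probability.LatticeModels.Site 3 => ⨅ A : {A : Finset
      (Literature.Probability.LatticeModels.Site 3) // (0 : Literature.Probability.LatticeModels.Site 3) ∈
      A ∧ y ∈ A}, -((Matrix.of fun (p q : ↥A.1) => Literature.Probability.LatticeModels.criticalTwoPoint 3
      (q.1 - p.1))⁻¹ ⟨0, A.2.1⟩ ⟨y, A.2.2⟩)) ∧ (∑' y : Literature.Probability.LatticeModels.Site 3,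
      ⨅ A : {A : Finset (Literature.Probability.LatticeModels.Site 3) // (0 :
      Literature.Probability.LatticeModels.Site 3) ∈ A ∧ y ∈ A},
      -((Matrix.of fun (p q : ↥A.1) => Literature.Probability.LatticeModels.criticalTwoPoint 3 (q.1 -
      p.1))⁻¹ ⟨0, A.2.1⟩ ⟨y, A.2.2⟩)) = 0 ∧ (∀ y : Literature.Probability.LatticeModels.Site 3, y ≠ 0 →
      0 ≤ ⨅ A : {A : Finset (Literature.Probability.LatticeModels.Site 3) // (0 :
      Literature.Probability.LatticeModels.Site 3) ∈ A ∧ y ∈ A},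
      -((Matrix.of fun (p q : ↥A.1) => Literature.Probability.LatticeModels.criticalTwoPoint 3 (q.1 -
      p.1))⁻¹ ⟨0, A.2.1⟩ ⟨y, A.2.2⟩)) ∧ (⨅ A : {A : Finset (Literature.Probability.LatticeModels.Site 3) //
      (0 : Literature.Probability.LatticeModels.Site 3) ∈ A ∧
      0 ∈ A}, -((Matrix.of fun (p q : ↥A.1) => Literature.Probability.LatticeModels.criticalTwoPoint 3 (q.1
      - p.1))⁻¹ ⟨0, A.2.1⟩ ⟨0, A.2.2⟩)) < 0 ∧ ∀ z : Literature.Probability.LatticeModels.Site 3,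
      (∑' y : Literature.Probability.LatticeModels.Site 3,
      (⨅ A : {A : Finset (Literature.Probability.LatticeModels.Site 3) // (0 :
      Literature.Probability.LatticeModels.Site 3) ∈ A ∧ y ∈ A},
      -((Matrix.of fun (p q : ↥A.1) => Literature.Probability.LatticeModels.criticalTwoPoint 3 (q.1 -
      p.1))⁻¹ ⟨0, A.2.1⟩ ⟨y, A.2.2⟩)) * Literature.Probability.LatticeModels.criticalTwoPoint 3 (z - y)) =
      if z = 0 then -1 else 0) → (∀ u : Literature.Probability.LatticeModels.Site 3, ((∃ i : Fin 3,
      u = Pi.single i 1) ∨ ∃ i j : Fin 3, i ≠ j ∧ (u = Pi.single i 1 + Pi.single j 1 ∨ u = Pi.single i 1 -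
      Pi.single j 1)) → ∀ (s : Finset (Literature.Probability.LatticeModels.Site 3)) (c :
      Literature.Probability.LatticeModels.Site 3 → ℝ), (∀ x ∈ s, 0 ≤ u ⬝ᵥ x) →
      ∃ μ : MeasureTheory.Measure ℝ, MeasureTheory.IsFiniteMeasure μ ∧ μ (Set.Icc (0 : ℝ) 1)ᶜ = 0 ∧
      ∀ n : ℕ, (∑ x ∈ s, ∑ y ∈ s, c x * c y * Literature.Probability.LatticeModels.criticalTwoPoint 3 (y +
      (n : ℤ) • u - (x - ((2 * (u ⬝ᵥ x)) / (u ⬝ᵥ u)) • u))) = ∫ t, t ^ n ∂μ) →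
      (∀ y : Literature.Probability.LatticeModels.Site 3, (⨅ A : {A : Finset
      (Literature.Probability.LatticeModels.Site 3) // (0 : Literature.Probability.LatticeModels.Site 3) ∈
      A ∧ -y ∈ A}, -((Matrix.of fun (p q : ↥A.1) => Literature.Probability.LatticeModels.criticalTwoPoint 3
      (q.1 - p.1))⁻¹ ⟨0, A.2.1⟩ ⟨-y, A.2.2⟩)) = (⨅ A : {A : Finset
      (Literature.Probability.LatticeModels.Site 3) // (0 : Literature.Probability.LatticeModels.Site 3) ∈
      A ∧ y ∈ A}, -((Matrix.of fun (p q : ↥A.1) => Literature.Probability.LatticeModels.criticalTwoPoint 3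
      (q.1 - p.1))⁻¹ ⟨0, A.2.1⟩ ⟨y, A.2.2⟩))) ∧ (ContinuousOn (fun k : Fin 3 →
      ℝ => 1 / (- ∑' y : Literature.Probability.LatticeModels.Site 3,
      (⨅ A : {A : Finset (Literature.Probability.LatticeModels.Site 3) // (0 :
      Literature.Probability.LatticeModels.Site 3) ∈ A ∧ y ∈ A},
      -((Matrix.of fun (p q : ↥A.1) => Literature.Probability.LatticeModels.criticalTwoPoint 3 (q.1 -
      p.1))⁻¹ ⟨0, A.2.1⟩ ⟨y, A.2.2⟩)) * Real.cos (∑ l, k l * (y l : ℝ)))) {k | ¬ ∀ i : Fin 3, ∃ n : ℤ,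
      k i = 2 * Real.pi * n} ∧ (∀ k : Fin 3 → ℝ, (¬ ∀ i : Fin 3, ∃ n : ℤ, k i = 2 * Real.pi * n) →
      0 < 1 / (- ∑' y : Literature.Probability.LatticeModels.Site 3,
      (⨅ A : {A : Finset (Literature.Probability.LatticeModels.Site 3) // (0 :
      Literature.Probability.LatticeModels.Site 3) ∈ A ∧ y ∈ A},
      -((Matrix.of fun (p q : ↥A.1) => Literature.Probability.LatticeModels.criticalTwoPoint 3 (q.1 -
      p.1))⁻¹ ⟨0, A.2.1⟩ ⟨y, A.2.2⟩)) * Real.cos (∑ l, k l * (y l : ℝ)))) ∧ (∀ (k : Fin 3 →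
      ℝ) (i : Fin 3), 1 / (- ∑' y : Literature.Probability.LatticeModels.Site 3,
      (⨅ A : {A : Finset (Literature.Probability.LatticeModels.Site 3) // (0 :
      Literature.Probability.LatticeModels.Site 3) ∈ A ∧ y ∈ A},
      -((Matrix.of fun (p q : ↥A.1) => Literature.Probability.LatticeModels.criticalTwoPoint 3 (q.1 -
      p.1))⁻¹ ⟨0, A.2.1⟩ ⟨y, A.2.2⟩)) * Real.cos (∑ l, (k + Pi.single i (2 * Real.pi) : Fin 3 →
      ℝ) l * (y l : ℝ))) = 1 / (- ∑' y : Literature.Probability.LatticeModels.Site 3,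
      (⨅ A : {A : Finset (Literature.Probability.LatticeModels.Site 3) // (0 :
      Literature.Probability.LatticeModels.Site 3) ∈ A ∧ y ∈ A},
      -((Matrix.of fun (p q : ↥A.1) => Literature.Probability.LatticeModels.criticalTwoPoint 3 (q.1 -
      p.1))⁻¹ ⟨0, A.2.1⟩ ⟨y, A.2.2⟩)) * Real.cos (∑ l, k l * (y l : ℝ)))) ∧
      ∀ u : Literature.Probability.LatticeModels.Site 3, ((∃ i : Fin 3, u = Pi.single i 1) ∨ ∃ i j : Fin 3,
      i ≠ j ∧ (u = Pi.single i 1 + Pi.single j 1 ∨ u = Pi.single i 1 - Pi.single j 1)) → ∀ k : Fin 3 →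
      ℝ, (∀ t : ℝ, ¬ ∀ i : Fin 3, ∃ n : ℤ, (k + t • (fun i => (u i : ℝ) / ∑ j,
      ((u j : ℝ)) ^ 2)) i = 2 * Real.pi * n) → ∃ μ : MeasureTheory.Measure ℝ,
      MeasureTheory.IsFiniteMeasure μ ∧ μ (Set.Ioo (-1 : ℝ) 1)ᶜ = 0 ∧
      ∀ t : ℝ, 1 / (- ∑' y : Literature.Probability.LatticeModels.Site 3,
      (⨅ A : {A : Finset (Literature.Probability.LatticeModels.Site 3) // (0 :
      Literature.Probability.LatticeModels.Site 3) ∈ A ∧ y ∈ A},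
      -((Matrix.of fun (p q : ↥A.1) => Literature.Probability.LatticeModels.criticalTwoPoint 3 (q.1 -
      p.1))⁻¹ ⟨0, A.2.1⟩ ⟨y, A.2.2⟩)) * Real.cos (∑ l, (k + t • (fun i => (u i : ℝ) / ∑ j,
      ((u j : ℝ)) ^ 2)) l * (y l : ℝ))) = ∫ s, (1 - s ^ 2) / (1 - 2 * s * Real.cos (((∑ i,
      k i * (u i : ℝ)) + t) / 2) + s ^ 2) ∂μ)) :=
  Iff.rfl

theorem expanded_crossLemma : Registered.stub_crossLemma ↔
    (∃ ρ : ℝ, 0 < ρ ∧ ∀ (f : (Fin 3 → ℂ) → ℂ) (M : ℝ), (∀ (j : Fin 3) (a : Fin 3 → ℝ), (∀ i, |a i| ≤ 1) →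
      DifferentiableOn ℂ (fun z : ℂ => f (Function.update (fun i => ((a i : ℝ) : ℂ)) j z)) (Metric.ball (0
      : ℂ) 2)) → (∀ (j : Fin 3) (a : Fin 3 → ℝ) (z : ℂ), (∀ i, |a i| ≤ 1) → ‖z‖ < 2 →
      ‖f (Function.update (fun i => ((a i : ℝ) : ℂ)) j z)‖ ≤ M) → ∃ g : (Fin 3 → ℂ) →
      ℂ, AnalyticOnNhd ℂ g {z | ∀ i, ‖z i‖ < ρ} ∧ (∀ z : Fin 3 → ℂ, (∀ i, ‖z i‖ < ρ) → ‖g z‖ ≤ M) ∧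
      ∀ (j : Fin 3) (a : Fin 3 → ℝ) (z : ℂ), (∀ i, |a i| ≤ 1) → ‖z‖ < 2 →
      (∀ i, ‖Function.update (fun i => ((a i : ℝ) : ℂ)) j z i‖ < ρ) →
      g (Function.update (fun i => ((a i : ℝ) : ℂ)) j z) = f (Function.update (fun i => ((a i : ℝ) : ℂ)) j
      z)) :=
  Iff.rfl

theorem expanded_crossAnalyticity : Registered.stub_crossAnalyticity ↔
    ((∃ ρ : ℝ, 0 < ρ ∧ ∀ (f : (Fin 3 → ℂ) → ℂ) (M : ℝ), (∀ (j : Fin 3) (a : Fin 3 → ℝ), (∀ i, |a i| ≤ 1) →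
      DifferentiableOn ℂ (fun z : ℂ => f (Function.update (fun i => ((a i : ℝ) : ℂ)) j z)) (Metric.ball (0
      : ℂ) 2)) → (∀ (j : Fin 3) (a : Fin 3 → ℝ) (z : ℂ), (∀ i, |a i| ≤ 1) → ‖z‖ < 2 →
      ‖f (Function.update (fun i => ((a i : ℝ) : ℂ)) j z)‖ ≤ M) → ∃ g : (Fin 3 → ℂ) →
      ℂ, AnalyticOnNhd ℂ g {z | ∀ i, ‖z i‖ < ρ} ∧ (∀ z : Fin 3 → ℂ, (∀ i, ‖z i‖ < ρ) → ‖g z‖ ≤ M) ∧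
      ∀ (j : Fin 3) (a : Fin 3 → ℝ) (z : ℂ), (∀ i, |a i| ≤ 1) → ‖z‖ < 2 →
      (∀ i, ‖Function.update (fun i => ((a i : ℝ) : ℂ)) j z i‖ < ρ) →
      g (Function.update (fun i => ((a i : ℝ) : ℂ)) j z) = f (Function.update (fun i => ((a i : ℝ) : ℂ)) j
      z)) → ∀ F : (Fin 3 → ℝ) → ℝ, (ContinuousOn F {k | ¬ ∀ i : Fin 3, ∃ n : ℤ, k i = 2 * Real.pi * n} ∧
      (∀ k : Fin 3 → ℝ, (¬ ∀ i : Fin 3, ∃ n : ℤ, k i = 2 * Real.pi * n) → 0 < F k) ∧ (∀ (k : Fin 3 →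
      ℝ) (i : Fin 3), F (k + Pi.single i (2 * Real.pi) : Fin 3 → ℝ) = F k) ∧
      ∀ u : Literature.Probability.LatticeModels.Site 3, ((∃ i : Fin 3, u = Pi.single i 1) ∨ ∃ i j : Fin 3,
      i ≠ j ∧ (u = Pi.single i 1 + Pi.single j 1 ∨ u = Pi.single i 1 - Pi.single j 1)) → ∀ k : Fin 3 →
      ℝ, (∀ t : ℝ, ¬ ∀ i : Fin 3, ∃ n : ℤ, (k + t • (fun i => (u i : ℝ) / ∑ j,
      ((u j : ℝ)) ^ 2)) i = 2 * Real.pi * n) → ∃ μ : MeasureTheory.Measure ℝ,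
      MeasureTheory.IsFiniteMeasure μ ∧ μ (Set.Ioo (-1 : ℝ) 1)ᶜ = 0 ∧
      ∀ t : ℝ, F (k + t • (fun i => (u i : ℝ) / ∑ j, ((u j : ℝ)) ^ 2)) = ∫ s,
      (1 - s ^ 2) / (1 - 2 * s * Real.cos (((∑ i, k i * (u i : ℝ)) + t) / 2) + s ^ 2) ∂μ) →
      (ContDiffOn ℝ (⊤ : ℕ∞) F {k | ¬ ∀ i : Fin 3, ∃ n : ℤ, k i = 2 * Real.pi * n} ∧
      ∀ n : ℕ, ∃ C r : ℝ, 0 < r ∧ ∀ k : Fin 3 → ℝ, k ≠ 0 → ‖k‖ ≤ r → ∃ k' : Fin 3 → ℝ, ‖k' - k‖ ≤ ‖k‖ / 2 ∧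
      ‖iteratedFDeriv ℝ n F k‖ * ‖k‖ ^ n ≤ C * (F k'))) :=
  Iff.rfl

theorem expanded_infraredGerm : Registered.stub_infraredGerm ↔
    ((∀ A : Finset (Literature.Probability.LatticeModels.Site 3),
      (Matrix.of fun (p q : ↥A) => Literature.Probability.LatticeModels.criticalTwoPoint 3 (q.1 -
      p.1)).PosDef ∧ ∀ u v : ↥A, (u ≠ v → (Matrix.of fun (p q : ↥A) =>
      Literature.Probability.LatticeModels.criticalTwoPoint 3 (q.1 - p.1))⁻¹ u v ≤ 0) ∧
      0 ≤ ∑ w, (Matrix.of fun (p q : ↥A) => Literature.Probability.LatticeModels.criticalTwoPoint 3 (q.1 -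
      p.1))⁻¹ u w) → (Summable (fun y : Literature.Probability.LatticeModels.Site 3 => ⨅ A : {A : Finset
      (Literature.Probability.LatticeModels.Site 3) // (0 : Literature.Probability.LatticeModels.Site 3) ∈
      A ∧ y ∈ A}, -((Matrix.of fun (p q : ↥A.1) => Literature.Probability.LatticeModels.criticalTwoPoint 3
      (q.1 - p.1))⁻¹ ⟨0, A.2.1⟩ ⟨y, A.2.2⟩)) ∧ (∑' y : Literature.Probability.LatticeModels.Site 3,
      ⨅ A : {A : Finset (Literature.Probability.LatticeModels.Site 3) // (0 :
      Literature.Probability.LatticeModels.Site 3) ∈ A ∧ y ∈ A},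
      -((Matrix.of fun (p q : ↥A.1) => Literature.Probability.LatticeModels.criticalTwoPoint 3 (q.1 -
      p.1))⁻¹ ⟨0, A.2.1⟩ ⟨y, A.2.2⟩)) = 0 ∧ (∀ y : Literature.Probability.LatticeModels.Site 3, y ≠ 0 →
      0 ≤ ⨅ A : {A : Finset (Literature.Probability.LatticeModels.Site 3) // (0 :
      Literature.Probability.LatticeModels.Site 3) ∈ A ∧ y ∈ A},
      -((Matrix.of fun (p q : ↥A.1) => Literature.Probability.LatticeModels.criticalTwoPoint 3 (q.1 -
      p.1))⁻¹ ⟨0, A.2.1⟩ ⟨y, A.2.2⟩)) ∧ (⨅ A : {A : Finset (Literature.Probability.LatticeModels.Site 3) //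
      (0 : Literature.Probability.LatticeModels.Site 3) ∈ A ∧
      0 ∈ A}, -((Matrix.of fun (p q : ↥A.1) => Literature.Probability.LatticeModels.criticalTwoPoint 3 (q.1
      - p.1))⁻¹ ⟨0, A.2.1⟩ ⟨0, A.2.2⟩)) < 0 ∧ ∀ z : Literature.Probability.LatticeModels.Site 3,
      (∑' y : Literature.Probability.LatticeModels.Site 3,
      (⨅ A : {A : Finset (Literature.Probability.LatticeModels.Site 3) // (0 :
      Literature.Probability.LatticeModels.Site 3) ∈ A ∧ y ∈ A},
      -((Matrix.of fun (p q : ↥A.1) => Literature.Probability.LatticeModels.criticalTwoPoint 3 (q.1 -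
      p.1))⁻¹ ⟨0, A.2.1⟩ ⟨y, A.2.2⟩)) * Literature.Probability.LatticeModels.criticalTwoPoint 3 (z - y)) =
      if z = 0 then -1 else 0) → (∃ (η : ℝ) (Θ : (Fin 3 → ℝ) → ℝ), 0 < η ∧ η < 1 ∧
      ContinuousOn Θ {u | ∑ i, u i ^ 2 = 1} ∧ (∀ u : Fin 3 → ℝ, ∑ i, u i ^ 2 = 1 → 0 < Θ u) ∧
      ∀ ε : ℝ, 0 < ε → ∃ s₀ : ℝ, 0 < s₀ ∧ ∀ s : ℝ, 0 < s → s < s₀ → ∀ k : Fin 3 →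
      ℝ, 1 ≤ Real.sqrt (∑ i, k i ^ 2) → Real.sqrt (∑ i, k i ^ 2) ≤ 2 →
      |(- ∑' y : Literature.Probability.LatticeModels.Site 3,
      (⨅ A : {A : Finset (Literature.Probability.LatticeModels.Site 3) // (0 :
      Literature.Probability.LatticeModels.Site 3) ∈ A ∧ y ∈ A},
      -((Matrix.of fun (p q : ↥A.1) => Literature.Probability.LatticeModels.criticalTwoPoint 3 (q.1 -
      p.1))⁻¹ ⟨0, A.2.1⟩ ⟨y, A.2.2⟩)) * Real.cos (∑ l, (s • k) l * (y l : ℝ))) / s ^ (2 - η) - Real.sqrt (∑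
      i, k i ^ 2) ^ (2 - η) * Θ (fun i => k i / Real.sqrt (∑ j, k j ^ 2))| < ε)) :=
  Iff.rfl

theorem expanded_symbolInversion : Registered.stub_symbolInversion ↔
    (∀ m : Literature.Probability.LatticeModels.Site 3 → ℝ, Summable m → (∑' y, m y) = 0 → (∀ y, y ≠ 0 →
      0 ≤ m y) → (∀ y, m (-y) = m y) → (∀ k : Fin 3 → ℝ, (¬ ∀ i : Fin 3, ∃ n : ℤ, k i = 2 * Real.pi * n) →
      0 < 1 / (- ∑' y : Literature.Probability.LatticeModels.Site 3, m y * Real.cos (∑ l,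
      k l * (y l : ℝ)))) → (ContDiffOn ℝ (⊤ : ℕ∞) (fun k : Fin 3 →
      ℝ => 1 / (- ∑' y : Literature.Probability.LatticeModels.Site 3, m y * Real.cos (∑ l,
      k l * (y l : ℝ)))) {k | ¬ ∀ i : Fin 3, ∃ n : ℤ, k i = 2 * Real.pi * n} ∧ ∀ n : ℕ, ∃ C r : ℝ, 0 < r ∧
      ∀ k : Fin 3 → ℝ, k ≠ 0 → ‖k‖ ≤ r → ∃ k' : Fin 3 → ℝ, ‖k' - k‖ ≤ ‖k‖ / 2 ∧
      ‖iteratedFDeriv ℝ n (fun k : Fin 3 → ℝ => 1 / (- ∑' y : Literature.Probability.LatticeModels.Site 3,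
      m y * Real.cos (∑ l, k l * (y l : ℝ)))) k‖ * ‖k‖ ^ n ≤ C * (1 / (- ∑' y :
      Literature.Probability.LatticeModels.Site 3, m y * Real.cos (∑ l, k' l * (y l : ℝ))))) →
      (∃ (η : ℝ) (Θ : (Fin 3 → ℝ) → ℝ), 0 < η ∧ η < 1 ∧ ContinuousOn Θ {u | ∑ i, u i ^ 2 = 1} ∧
      (∀ u : Fin 3 → ℝ, ∑ i, u i ^ 2 = 1 → 0 < Θ u) ∧ ∀ ε : ℝ, 0 < ε → ∃ s₀ : ℝ, 0 < s₀ ∧ ∀ s : ℝ, 0 < s →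
      s < s₀ → ∀ k : Fin 3 → ℝ, 1 ≤ Real.sqrt (∑ i, k i ^ 2) → Real.sqrt (∑ i, k i ^ 2) ≤ 2 →
      |(- ∑' y : Literature.Probability.LatticeModels.Site 3, m y * Real.cos (∑ l,
      (s • k) l * (y l : ℝ))) / s ^ (2 - η) - Real.sqrt (∑ i,
      k i ^ 2) ^ (2 - η) * Θ (fun i => k i / Real.sqrt (∑ j, k j ^ 2))| < ε) → (∃ (η : ℝ) (Φ : (Fin 3 →
      ℝ) → ℝ), 0 < η ∧ η < 1 ∧ ContinuousOn Φ {u | ∑ i, u i ^ 2 = 1} ∧ (∀ u : Fin 3 → ℝ, ∑ i, u i ^ 2 = 1 →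
      0 ≤ Φ u) ∧ (∃ u : Fin 3 → ℝ, ∑ i, u i ^ 2 = 1 ∧ 0 < Φ u) ∧
      Filter.Tendsto (fun x : Literature.Probability.LatticeModels.Site 3 => m x * Real.sqrt (∑ j,
      ((x j : ℝ)) ^ 2) ^ (5 - η) - Φ (fun i => (x i : ℝ) / Real.sqrt (∑ j,
      ((x j : ℝ)) ^ 2))) Filter.cofinite (nhds 0))) :=
  Iff.rfl

end Summit.CriticalPhenomena.Ising3DConformalLimit.Cruxes.DirectCorrelationStableTail.NineFrameCrossAnalyticity

end
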